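import Summits.ValiantsHypothesis.ValiantsHypothesis.Theorems.KPlusLogSqLawTropicalBSignParity
import Mathlib.LinearAlgebra.Dual.Lemmas

/-!
# Route `KPlusLogSqLaw`, crux `TropicalB` (stmt-ValiantsHypothesis-19771) — THE SIGN PARITY LAW IS COMPLETE:
# an alternating sign table exists iff no odd even-cover; the SIGNED row without valuations, slopes or signs

HONEST FRAMING.  Helper file (seat val-sym-trop-p1 g26, cell `pub-symmetroid`, 2026-08-29; `--supports stmt-ValiantsHypothesis-19771
--as helper`) toward the registered stubs `stub_tropThin` / `stub_tropFat` of `Cruxes/TropicalB/Lines/birth.lean` (crux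
`Summit.ValiantsHypothesis.ValiantsHypothesis.Theses.KPlusLogSqLaw.TropicalB`, route `KPlusLogSqLaw`).  Structure theorems (exact criteria),
route-independent imports; nothing here bounds anything: `TropicalB` / both stubs stay OPEN; nothing on `WeakLifting`, the cell's census
values, DoorA26 / DoorA34, `MatrixDescartes` (stmt-ValiantsHypothesis-18050) or VP ≠ VNP.

THE POINT.  `sign_parity_law` (…TropicalBSignParity) is the obstruction to signing a term sequence: an even cover of the cells by the terms of
a set of steps forces an even number of even-quotient steps.  Here the CONVERSE: if no odd even-cover exists, a `±1` sign table making all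
consecutive formal signs alternate EXISTS (`exists_signTable_of_parity`) — linear algebra over `𝔽₂` (the unknowns are the cell signs, one
equation per step; a dual vector annihilating the coefficient matrix is exactly an even cover), through a coordinate form of
`Subspace.forall_mem_dualAnnihilator_apply_eq_zero_iff` (`exists_mulVec_eq_of_forall_vecMul`, any field).  Hence the kernel iffs
`exists_signTable_iff_parity` and — with `MasterLaw.tropRootLawAt_iff_signedCertificateFree` — `tropRootLawAt_iff_parity_certificateFree`:
**the signed census row `TropRootLawAt m K B` (the row of the crux) is a statement about term sequences alone** — (a) parity condition on
even covers, (b) no Farkas certificate ⇒ `n ≤ B`.  Toolkit: `count_inc`, `sum_count_inc_mul` (incidence counts), `prod_signTable_eq`,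
`card_filter_cast_eq_sum`.  [this cell; the linear algebra is folklore]
-/

set_option linter.dupNamespace false
set_option autoImplicit false

namespace Summit.ValiantsHypothesis.ValiantsHypothesis.Theorems.KPlusLogSqLaw.SignParity

open Summit.ValiantsHypothesis.ValiantsHypothesis.Theorems.MatrixDescartes.Negative
open Summit.ValiantsHypothesis.ValiantsHypothesis.Theorems.KPlusLogSqLaw.ConvexPosition
open scoped BigOperators
open Finset Matrix

variable {m K : ℕ}

/-! ## 1. The Fredholm alternative for linear systems over a field (coordinates) -/

/-- **solvability of `A x = r` from the dual side**: over a field, if every vector `u` with `u ᵥ* A = 0` has `u ⬝ᵥ r = 0`, then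
`A *ᵥ x = r` has a solution.  (Coordinates for `Subspace.forall_mem_dualAnnihilator_apply_eq_zero_iff`.) [folklore] -/
theorem exists_mulVec_eq_of_forall_vecMul {F : Type*} [Field F] {ι κ : Type*} [Fintype ι] [Fintype κ] [DecidableEq ι]
    [DecidableEq κ] (A : Matrix ι κ F) (r : ι → F) (h : ∀ u : ι → F, u ᵥ* A = 0 → u ⬝ᵥ r = 0) :
    ∃ x : κ → F, A *ᵥ x = r := by
  have hr : r ∈ LinearMap.range (Matrix.mulVecLin A) := by
    rw [← Subspace.forall_mem_dualAnnihilator_apply_eq_zero_iff]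
    intro φ hφ
    rw [Submodule.mem_dualAnnihilator] at hφ
    -- the coordinate vector of `φ`
    set u : ι → F := fun i => φ (fun j => if i = j then 1 else 0) with hu
    have hφu : ∀ w : ι → F, φ w = u ⬝ᵥ w := by
      intro w
      rw [LinearMap.pi_apply_eq_sum_univ φ w, dotProduct]
      refine Finset.sum_congr rfl fun i _ => ?_
      rw [smul_eq_mul, mul_comm]
    have huA : u ᵥ* A = 0 := by
      funext j
      have h0 := hφ (A *ᵥ (Pi.single j 1)) ⟨Pi.single j 1, rfl⟩
      rw [hφu, dotProduct_mulVec, dotProduct_single, mul_one] at h0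
      exact h0
    rw [hφu]
    exact h u huA
  obtain ⟨x, hx⟩ := hr
  exact ⟨x, hx⟩

/-! ## 2. Incidence counts -/

/-- a term has each of its incidences exactly once: `count c (inc t)` is the indicator of «`c` is the incidence of `t` in column `c.2.1`».
[folklore] -/
theorem count_inc (t : Equiv.Perm (Fin m) × (Fin m → Fin K)) (c : Fin m × Fin m × Fin K) :
    (inc t).count c = if t.1 c.2.1 = c.1 ∧ t.2 c.2.1 = c.2.2 then 1 else 0 := by
  classical
  unfold inc
  rw [Multiset.count_map]
  have hset : (Multiset.filter (fun b => c = (t.1 b, b, t.2 b)) (univ : Finset (Fin m)).val) =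
      (univ.filter fun b => c = (t.1 b, b, t.2 b)).val := rfl
  rw [hset, Finset.card_val]
  split_ifs with h
  · rw [Finset.card_eq_one]
    refine ⟨c.2.1, ?_⟩
    ext b
    simp only [Finset.mem_filter, Finset.mem_univ, true_and, Finset.mem_singleton]
    constructor
    · intro hb; rw [hb]
    · intro hb; subst hb; obtain ⟨h1, h2⟩ := h; ext <;> simp [h1, h2]
  · rw [Finset.card_eq_zero, Finset.filter_eq_empty_iff]
    intro b _ hb
    apply h
    rw [hb]; exact ⟨rfl, rfl⟩

/-- summing a weight against the incidence counts of a term gives the sum of the weight over the term's incidences. [folklore] -/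
theorem sum_count_inc_mul {R : Type*} [CommSemiring R] (t : Equiv.Perm (Fin m) × (Fin m → Fin K))
    (x : Fin m × Fin m × Fin K → R) :
    ∑ c, ((inc t).count c : R) * x c = ∑ b, x (t.1 b, b, t.2 b) := by
  classical
  have h1 : ∀ c : Fin m × Fin m × Fin K, ((inc t).count c : R) * x c =
      if t.1 c.2.1 = c.1 ∧ t.2 c.2.1 = c.2.2 then x c else 0 := by
    intro c; rw [count_inc]; split_ifs <;> simp
  rw [Finset.sum_congr rfl fun c _ => h1 c]
  rw [Fintype.sum_prod_type, Finset.sum_comm, Fintype.sum_prod_type]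
  refine Finset.sum_congr rfl fun b _ => ?_
  dsimp only
  rw [Finset.sum_eq_single (t.2 b)]
  · rw [Finset.sum_eq_single (t.1 b)]
    · simp
    · intro a _ ha; simp [Ne.symm ha]
    · simp
  · intro l _ hl; exact Finset.sum_eq_zero fun a _ => by simp [Ne.symm hl]
  · simp

/-! ## 3. Completeness of the sign parity law -/

/-- the product of a `±1` pattern read off a `ZMod 2` vector is `(−1)^{number of ones}`. [folklore] -/
theorem prod_signTable_eq (x : Fin m × Fin m × Fin K → ZMod 2) (t : Equiv.Perm (Fin m) × (Fin m → Fin K)) :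
    ∏ b, (if x (t.1 b, b, t.2 b) = 1 then (-1 : ℤ) else 1) =
      (-1) ^ (univ.filter fun b => x (t.1 b, b, t.2 b) = 1).card := by
  rw [Finset.prod_ite, Finset.prod_const, Finset.prod_const_one, mul_one]

/-- the number of ones of a `ZMod 2` vector along a term, cast to `ZMod 2`, is the sum of the vector along the term. [folklore] -/
theorem card_filter_cast_eq_sum (x : Fin m × Fin m × Fin K → ZMod 2) (t : Equiv.Perm (Fin m) × (Fin m → Fin K)) :
    (((univ.filter fun b => x (t.1 b, b, t.2 b) = 1).card : ℕ) : ZMod 2) = ∑ b, x (t.1 b, b, t.2 b) := by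
  rw [← Finset.sum_boole]
  refine Finset.sum_congr rfl fun b _ => ?_
  rcases (show ∀ z : ZMod 2, z = 0 ∨ z = 1 by decide) (x (t.1 b, b, t.2 b)) with h | h <;> simp [h]

/-- **COMPLETENESS OF THE SIGN PARITY LAW.**  If every set `J` of steps (below `n`) whose `2|J|` terms cover every cell an even number of
times contains an even number of even-quotient steps, then SOME `±1` table makes all `n` consecutive formal signs alternate.  Linear algebra
over `𝔽₂`: the unknowns are the cell signs, the equations (one per step) read «sum over the symmetric difference of the two incidence sets =
[the two permutation signs agree]»; a dual vector annihilating the coefficient matrix is exactly an even cover, so the hypothesis is the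
Fredholm condition (`exists_mulVec_eq_of_forall_vecMul`). [this cell; the linear algebra is folklore] -/
theorem exists_signTable_of_parity (n : ℕ) (p : ℕ → Equiv.Perm (Fin m) × (Fin m → Fin K))
    (hpar : ∀ J : Finset ℕ, J ⊆ Finset.range n →
      (∀ c, Even ((∑ k ∈ J, (inc (p k) + inc (p (k + 1)))).count c)) →
      Even ((J.filter fun k => Equiv.Perm.sign (p k).1 = Equiv.Perm.sign (p (k + 1)).1).card)) :
    ∃ s : Fin m → Fin m → Fin K → ℤ, (∀ a b l, s a b l = 1 ∨ s a b l = -1) ∧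
      ∀ k < n, termSign s (p k) * termSign s (p (k + 1)) < 0 := by
  classical
  -- the 𝔽₂ system
  let A : Matrix (Fin n) (Fin m × Fin m × Fin K) (ZMod 2) := fun k c =>
    (((inc (p k)).count c : ℕ) : ZMod 2) + (((inc (p (k + 1))).count c : ℕ) : ZMod 2)
  let r : Fin n → ZMod 2 := fun k => if Equiv.Perm.sign (p k).1 = Equiv.Perm.sign (p (k + 1)).1 then 1 else 0
  -- Fredholm condition = the parity hypothesis
  have hsol : ∃ x, A *ᵥ x = r := by
    refine exists_mulVec_eq_of_forall_vecMul A r fun u hu => ?_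
    let J' : Finset (Fin n) := univ.filter fun k => u k = 1
    let J : Finset ℕ := J'.map Fin.valEmbedding
    have hJ : J ⊆ Finset.range n := by
      intro k hk
      simp only [J, Finset.mem_map, Fin.valEmbedding_apply] at hk
      obtain ⟨k', -, rfl⟩ := hk
      exact Finset.mem_range.mpr k'.isLt
    have hu01 : ∀ k, u k = if u k = 1 then 1 else 0 := by
      intro k; rcases (show ∀ z : ZMod 2, z = 0 ∨ z = 1 by decide) (u k) with h | h <;> simp [h]
    -- even cover
    have hcover : ∀ c, Even ((∑ k ∈ J, (inc (p k) + inc (p (k + 1)))).count c) := by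
      intro c
      have h0 := congrFun hu c
      simp only [vecMul, dotProduct, Pi.zero_apply] at h0
      rw [← ZMod.natCast_eq_zero_iff_even]
      rw [Finset.sum_map, Multiset.count_sum']
      push_cast
      rw [← h0]
      rw [Finset.sum_filter]
      refine Finset.sum_congr rfl fun k _ => ?_
      rw [Multiset.count_add]
      push_cast
      rcases (show ∀ z : ZMod 2, z = 0 ∨ z = 1 by decide) (u k) with h | h <;> simp [h, A]
    have hev := hpar J hJ hcover
    -- hence `u ⬝ᵥ r = 0`
    have hcard : ((J.filter fun k => Equiv.Perm.sign (p k).1 = Equiv.Perm.sign (p (k + 1)).1).card : ZMod 2) = u ⬝ᵥ r := by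
      rw [dotProduct]
      have : (J.filter fun k => Equiv.Perm.sign (p k).1 = Equiv.Perm.sign (p (k + 1)).1).card =
          (J'.filter fun k : Fin n => Equiv.Perm.sign (p k).1 = Equiv.Perm.sign (p (k + 1)).1).card := by
        rw [show (J.filter fun k => Equiv.Perm.sign (p k).1 = Equiv.Perm.sign (p (k + 1)).1) =
          (J'.filter fun k : Fin n => Equiv.Perm.sign (p k).1 = Equiv.Perm.sign (p (k + 1)).1).map Fin.valEmbedding from ?_]
        · exact Finset.card_map _
        · rw [Finset.filter_map]; rfl
      rw [this, ← Finset.sum_boole, Finset.sum_filter]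
      refine Finset.sum_congr rfl fun k _ => ?_
      rcases (show ∀ z : ZMod 2, z = 0 ∨ z = 1 by decide) (u k) with h | h <;> simp [h, r]
    rw [← hcard, ZMod.natCast_eq_zero_iff_even]
    exact hev
  obtain ⟨x, hx⟩ := hsol
  -- the sign table
  refine ⟨fun a b l => if x (a, b, l) = 1 then -1 else 1, fun a b l => by dsimp only; split_ifs <;> simp, fun k hk => ?_⟩
  -- the equation of step `k`
  have hxk := congrFun hx ⟨k, hk⟩
  simp only [mulVec, dotProduct, A, r, add_mul, Finset.sum_add_distrib] at hxk
  rw [sum_count_inc_mul, sum_count_inc_mul, ← card_filter_cast_eq_sum, ← card_filter_cast_eq_sum, ← Nat.cast_add] at hxk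
  -- rewrite the two formal signs
  have hT : ∀ t : Equiv.Perm (Fin m) × (Fin m → Fin K),
      termSign (fun a b l => if x (a, b, l) = 1 then (-1 : ℤ) else 1) t =
        (Equiv.Perm.sign t.1 : ℤ) * (-1) ^ (univ.filter fun b => x (t.1 b, b, t.2 b) = 1).card := by
    intro t; unfold termSign; rw [prod_signTable_eq]
  rw [hT, hT]
  set N₁ := (univ.filter fun b => x ((p k).1 b, b, (p k).2 b) = 1).card
  set N₂ := (univ.filter fun b => x ((p (k + 1)).1 b, b, (p (k + 1)).2 b) = 1).card
  have hrearr : (Equiv.Perm.sign (p k).1 : ℤ) * (-1) ^ N₁ * ((Equiv.Perm.sign (p (k + 1)).1 : ℤ) * (-1) ^ N₂) =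
      ((Equiv.Perm.sign (p k).1 : ℤ) * (Equiv.Perm.sign (p (k + 1)).1 : ℤ)) * (-1) ^ (N₁ + N₂) := by
    rw [pow_add]; ring
  rw [hrearr, sign_mul_sign_eq_ite]
  by_cases heq : Equiv.Perm.sign (p k).1 = Equiv.Perm.sign (p (k + 1)).1
  · rw [if_pos heq] at hxk ⊢
    have hodd : Odd (N₁ + N₂) := by rwa [← ZMod.natCast_eq_one_iff_odd]
    rw [hodd.neg_one_pow]; norm_num
  · rw [if_neg heq] at hxk ⊢
    have heven : Even (N₁ + N₂) := by rwa [← ZMod.natCast_eq_zero_iff_even]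
    rw [heven.neg_one_pow]; norm_num

/-- **SIGN TABLES WITHOUT SIGNS (kernel iff).**  A term sequence admits a `±1` table making its first `n` consecutive formal signs alternate
iff every even cover by steps below `n` contains an even number of even-quotient steps (`sign_parity_law` and its completeness). [this cell] -/
theorem exists_signTable_iff_parity (n : ℕ) (p : ℕ → Equiv.Perm (Fin m) × (Fin m → Fin K)) :
    (∃ s : Fin m → Fin m → Fin K → ℤ, (∀ a b l, s a b l = 1 ∨ s a b l = -1) ∧
      ∀ k < n, termSign s (p k) * termSign s (p (k + 1)) < 0) ↔
    (∀ J : Finset ℕ, J ⊆ Finset.range n →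
      (∀ c, Even ((∑ k ∈ J, (inc (p k) + inc (p (k + 1)))).count c)) →
      Even ((J.filter fun k => Equiv.Perm.sign (p k).1 = Equiv.Perm.sign (p (k + 1)).1).card)) := by
  constructor
  · rintro ⟨s, -, halt⟩ J hJ hcover
    exact sign_parity_law J s p hcover fun k hk => halt k (Finset.mem_range.mp (hJ hk))
  · exact exists_signTable_of_parity n p

/-! ## 4. The signed census row without valuations, slopes or signs -/

/-- **THE SIGNED ROW IS PURE COMBINATORICS (kernel iff).**  `TropRootLawAt m K B` — «every sign-alternating dominant chain of every
`(m, K)` design has at most `B` steps», the row of the crux — holds iff every exponent vector `d` and every term sequence `p 0, …, p n`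
satisfying (a) the PARITY CONDITION «every even cover by steps below `n` contains an even number of even-quotient steps» and (b) NO FARKAS
CERTIFICATE (as in `MasterLaw.exists_design_iff_no_certificate`) has `n ≤ B`.  Valuations, sampling slopes AND signs are eliminated.
(`MasterLaw.tropRootLawAt_iff_signedCertificateFree` with `exists_signTable_iff_parity`.) [this cell] -/
theorem tropRootLawAt_iff_parity_certificateFree (m K B : ℕ) :
    Summit.ValiantsHypothesis.ValiantsHypothesis.Theorems.LacunarySymmetroidMatrixDescartes.TropicalCensus.TropRootLawAt m K B ↔
    ∀ (d : Fin K → ℕ) (n : ℕ) (p : ℕ → Equiv.Perm (Fin m) × (Fin m → Fin K)),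
      (∀ J : Finset ℕ, J ⊆ Finset.range n →
        (∀ c, Even ((∑ k ∈ J, (inc (p k) + inc (p (k + 1)))).count c)) →
        Even ((J.filter fun k => Equiv.Perm.sign (p k).1 = Equiv.Perm.sign (p (k + 1)).1).card)) →
      (∀ lam : ℕ → (Equiv.Perm (Fin m) × (Fin m → Fin K)) → ℚ, (∀ k q, 0 ≤ lam k q) →
        (∀ k q, lam k q ≠ 0 → k ≤ n ∧ q ≠ p k ∧ ∀ b, ∃ k' ≤ n, (p k').1 b = q.1 b ∧ (p k').2 b = q.2 b) →
        (∀ F : Fin m × Fin m × Fin K → ℤ, ∑ k ∈ range (n + 1), ∑ q, lam k q * ((ev F (p k) : ℚ) - (ev F q : ℚ)) = 0) →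
        (∀ k < n, 0 ≤ ∑ k' ∈ range (k + 1), ∑ q, lam k' q *
          ((Summit.ValiantsHypothesis.ValiantsHypothesis.Theorems.LacunarySymmetroidMatrixDescartes.TropicalCensus.slope d (p k') : ℚ) -
           (Summit.ValiantsHypothesis.ValiantsHypothesis.Theorems.LacunarySymmetroidMatrixDescartes.TropicalCensus.slope d q : ℚ))) →
        ∀ k q, lam k q = 0) →
      n ≤ B := by
  rw [MasterLaw.tropRootLawAt_iff_signedCertificateFree]
  refine forall_congr' fun d => forall_congr' fun n => forall_congr' fun p => ?_
  rw [exists_signTable_iff_parity]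

end Summit.ValiantsHypothesis.ValiantsHypothesis.Theorems.KPlusLogSqLaw.SignParity
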